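import Literature.NumberTheory.QuadraticFields.InfrastructureSquaring
import HarnessLib

/-!
# Reducing a frame: Lagrange–Gauss reduction with the distance correction `-log(2Δ²) ≤ κ ≤ 0`

Topic `NumberTheory/QuadraticFields` (the infrastructure of a real quadratic order, VI), continuing
`InfrastructureSquaring.lean`. A frame `(a, b, θ, θψ)` produced by squaring satisfies the invariant
`Inv` but is not reduced. Following Jacobson–Williams §5.1–5.2 (the continued-fraction reduction of
`[Q/r, (P + √D)/r]`, Thm. 5.9, (5.6), (5.12)) we reduce it by

* `normalize` — replace `b` by its representative mod `2a` in `(-a, a]` when `a > √Δ`, in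
  `(⌊√Δ⌋ - 2a, ⌊√Δ⌋]` when `a < √Δ` (`θ` unchanged, `θψ ↦ θψ + kθ`);
* `pstep` — the step `(a, b, θ, θψ) ↦ (|c|, -b, ±θψ, θ)`, `c = (Δ - b²)/4a` (op. cit. (5.3)–(5.5)
  without the sign convention `a > 0` of reduced ideals), under which `θ' = θ · 2|c|/(√Δ - b)`;
* `rloop = if reduced then id else normalize ∘ pstep`, iterated: `reduce S n = rloopⁿ (normalize S)`.

Main results: `Inv` is preserved throughout; `RedTest` (three integer comparisons) decides `Red`;
while `a > √Δ` each step divides `a` by at least `4` and multiplies `|θ|` by a factor in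
`[a'/a, 1)` (op. cit. (5.6): `N(ρ(𝔞)) ≤ (|a| + Δ/|a|)/4`); once `a < √Δ` at most one more step is
needed, with factor in `(1/2Δ, 1)`, after which the frame is reduced (op. cit. Thm. 5.9: `N(𝔞) < √Δ/2`
implies reduced); hence **`Inv.reduce_spec`**: for `n ≥ L + 1` with `4ᴸ > a`, `reduce S n` is a
reduced frame with `|θ|/(2Δa) ≤ |θ_n| ≤ |θ|` (op. cit. (5.12): `r/Q₀ < |θ_m| < 2`, here in the weaker
form sufficient for polynomial running time). The sign of `θ` flips at a step exactly when `b > √Δ`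
(`Inv.ev_pstep_p`).

Everything is proved; no named facts.

## References

* M. J. Jacobson, Jr., H. C. Williams, *Solving the Pell Equation*, CMS Books in Mathematics, Springer
  (2009), §5.1 (5.3)–(5.6), Thm. 5.9, Thm. 5.10, (5.12); §5.2 (reduction algorithms). [JacobsonWilliams2008]
-/

noncomputable section

open scoped Classical

namespace Literature.NumberTheory.QuadraticFields.Infra

variable {Δ : ℕ} {S : St}

/-! ### Normalisation of `b` -/

/-- The normalised numerator: `b mod 2a` in `(-a, a]` if `a > ⌊√Δ⌋`, in `(⌊√Δ⌋ - 2a, ⌊√Δ⌋]` otherwise.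
[cite: JacobsonWilliams2008, §5.1 Thm. 5.10 (normalisation `β = k|a| + b + ω`)] -/
def St.bn (Δ : ℕ) (S : St) : ℤ :=
  if (Nat.sqrt Δ : ℤ) < S.a then (S.b + S.a - 1) % (2 * S.a) - S.a + 1
  else Nat.sqrt Δ - (Nat.sqrt Δ - S.b) % (2 * S.a)

/-- The shift `k = (b_n - b)/2a`. [folklore] -/
def St.kn (Δ : ℕ) (S : St) : ℤ := (S.bn Δ - S.b) / (2 * S.a)

/-- **Normalisation** `(a, b, θ, θψ) ↦ (a, b_n, θ, θψ + kθ)`. [cite: JacobsonWilliams2008, §5.1 Thm. 5.10] -/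
def normalize (Δ : ℕ) (S : St) : St := ⟨S.a, S.bn Δ, S.p, lin (S.kn Δ) 1 S.p S.r⟩

/-- A frame is normalised when `b` lies in the range of `St.bn`. [cite: JacobsonWilliams2008, §5.1 Thm. 5.10] -/
def Norm (Δ : ℕ) (S : St) : Prop :=
  ((Nat.sqrt Δ : ℤ) < S.a → -(S.a : ℤ) < S.b ∧ S.b ≤ S.a) ∧
    ((S.a : ℤ) ≤ Nat.sqrt Δ → (Nat.sqrt Δ : ℤ) - 2 * S.a < S.b ∧ S.b ≤ Nat.sqrt Δ)

/-- Normalisation keeps `a`. [folklore] -/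
@[simp] theorem normalize_a (S : St) : (Infra.normalize Δ S).a = S.a := rfl
/-- Normalisation replaces `b` by `bn`. [folklore] -/
@[simp] theorem normalize_b (S : St) : (Infra.normalize Δ S).b = S.bn Δ := rfl
/-- Normalisation keeps `θ`. [folklore] -/
@[simp] theorem normalize_p (S : St) : (Infra.normalize Δ S).p = S.p := rfl
/-- Normalisation replaces `θψ` by `θ(ψ + kn)`. [folklore] -/
@[simp] theorem normalize_r (S : St) : (Infra.normalize Δ S).r = lin (S.kn Δ) 1 S.p S.r := rfl

/-- `b_n - b = 2a k` exactly. [folklore] -/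
theorem bn_sub_b (ha : 1 ≤ S.a) : S.bn Δ - S.b = 2 * S.a * S.kn Δ := by
  have h2a : (2 * (S.a : ℤ)) ≠ 0 := by omega
  have hdvd : 2 * (S.a : ℤ) ∣ S.bn Δ - S.b := by
    unfold St.bn
    split_ifs with h
    · have := Int.emod_add_mul_ediv (S.b + S.a - 1) (2 * S.a)
      exact ⟨-((S.b + S.a - 1) / (2 * S.a)), by linarith⟩
    · have := Int.emod_add_mul_ediv ((Nat.sqrt Δ : ℤ) - S.b) (2 * S.a)
      exact ⟨((Nat.sqrt Δ : ℤ) - S.b) / (2 * S.a), by linarith⟩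
  unfold St.kn
  exact (Int.mul_ediv_cancel' hdvd).symm

/-- The normalised frame is normalised. [cite: JacobsonWilliams2008, §5.1 Thm. 5.10] -/
theorem norm_normalize (ha : 1 ≤ S.a) : Norm Δ (Infra.normalize Δ S) := by
  have h2a : 0 < 2 * (S.a : ℤ) := by omega
  constructor
  · intro h
    simp only [normalize_a, normalize_b] at h ⊢
    unfold St.bn; rw [if_pos h]
    have h0 := Int.emod_nonneg (S.b + S.a - 1) h2a.ne'
    have h1 := Int.emod_lt_of_pos (S.b + S.a - 1) h2a
    constructor <;> omega
  · intro h
    simp only [normalize_a, normalize_b] at h ⊢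
    unfold St.bn; rw [if_neg (by omega)]
    have h0 := Int.emod_nonneg ((Nat.sqrt Δ : ℤ) - S.b) h2a.ne'
    have h1 := Int.emod_lt_of_pos ((Nat.sqrt Δ : ℤ) - S.b) h2a
    constructor <;> omega

/-- **Normalisation preserves the invariant** (`θ` unchanged). [cite: JacobsonWilliams2008, §5.1 Thm. 5.10] -/
theorem Inv.normalize (hI : Inv Δ S) : Inv Δ (Infra.normalize Δ S) := by
  have hk := bn_sub_b (Δ := Δ) hI.1
  refine ⟨hI.1, ?_, ?_, ?_⟩
  · simp only [normalize_a, normalize_b]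
    obtain ⟨q, hq⟩ := hI.2.1
    refine ⟨q - S.kn Δ * (S.b + S.a * S.kn Δ), ?_⟩
    have : S.bn Δ = S.b + 2 * S.a * S.kn Δ := by linarith
    rw [this]
    linear_combination hq
  · intro t ht
    have hold := hI.2.2.1 t ht
    have hk' : (S.bn Δ : ℝ) - S.b = 2 * S.a * S.kn Δ := by exact_mod_cast hk
    simp only [normalize_a, normalize_b, normalize_p, normalize_r]
    rw [ev_lin]
    push_cast
    linear_combination hold - ev Δ t S.p * hk'
  · intro q
    obtain ⟨x, y, hq⟩ := hI.2.2.2 q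
    refine ⟨x - y * S.kn Δ, y, ?_⟩
    rw [hq]; simp only [normalize_p, normalize_r]; unfold lin; ext <;> simp only <;> ring

/-! ### The reducedness test -/

/-- **Integer test for reducedness**: `b ≤ ⌊√Δ⌋`, `⌊√Δ⌋ + 1 ≤ b + 2a`, `2a - b ≤ ⌊√Δ⌋`.
[cite: JacobsonWilliams2008, §5.1 Thm. 5.10 (criterion `β > |a|`)] -/
def RedTest (Δ : ℕ) (S : St) : Prop :=
  S.b ≤ Nat.sqrt Δ ∧ (Nat.sqrt Δ : ℤ) + 1 ≤ S.b + 2 * S.a ∧ 2 * (S.a : ℤ) - S.b ≤ Nat.sqrt Δ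

/-- The integer test decides `Red`. [cite: JacobsonWilliams2008, §5.1 Thm. 5.10] -/
theorem redTest_iff (hΔ : IsDisc Δ) (S : St) : RedTest Δ S ↔ Red Δ S := by
  obtain ⟨hs1, hs2⟩ := nat_sqrt_lt_rt hΔ
  unfold RedTest Red
  rw [abs_lt]
  constructor
  · rintro ⟨h1, h2, h3⟩
    have h1' : (S.b : ℝ) ≤ Nat.sqrt Δ := by exact_mod_cast h1
    have h2' : (Nat.sqrt Δ : ℝ) + 1 ≤ S.b + 2 * S.a := by exact_mod_cast h2
    have h3' : 2 * (S.a : ℝ) - S.b ≤ Nat.sqrt Δ := by exact_mod_cast h3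
    exact ⟨⟨by linarith, by linarith⟩, by linarith⟩
  · rintro ⟨⟨h1, h2⟩, h3⟩
    refine ⟨?_, ?_, ?_⟩
    · by_contra h; push Not at h
      have : (Nat.sqrt Δ : ℝ) + 1 ≤ S.b := by exact_mod_cast h
      linarith
    · by_contra h; push Not at h
      have : (S.b : ℝ) + 2 * S.a ≤ Nat.sqrt Δ := by exact_mod_cast (show S.b + 2 * S.a ≤ Nat.sqrt Δ by omega)
      linarith
    · by_contra h; push Not at h
      have : (Nat.sqrt Δ : ℝ) + 1 ≤ 2 * S.a - S.b := by exact_mod_cast (show (Nat.sqrt Δ : ℤ) + 1 ≤ 2 * S.a - S.b by omega)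
      linarith

/-- A reduced frame has `a ≤ ⌊√Δ⌋`. [cite: JacobsonWilliams2008, §5.1 Cor. 5.8.1] -/
theorem Red.a_le_sqrt (hΔ : IsDisc Δ) (hR : Red Δ S) : (S.a : ℤ) ≤ Nat.sqrt Δ := by
  have h1 := hR.a_lt_rt
  have h2 := (nat_sqrt_lt_rt hΔ).2
  by_contra h; push Not at h
  have : (Nat.sqrt Δ : ℝ) + 1 ≤ S.a := by exact_mod_cast h
  linarith

/-- **Small norm implies reduced**: a normalised frame with `2a ≤ ⌊√Δ⌋` is reduced
(Jacobson–Williams Thm. 5.9). [cite: JacobsonWilliams2008, §5.1 Thm. 5.9] -/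
theorem Norm.red_of_small (hΔ : IsDisc Δ) (hN : Norm Δ S) (h2a : 2 * (S.a : ℤ) ≤ Nat.sqrt Δ)
    (ha : 1 ≤ S.a) : Red Δ S := by
  rw [← redTest_iff hΔ]
  obtain ⟨h1, h2⟩ := hN.2 (by omega)
  exact ⟨h2, by omega, by omega⟩

/-! ### The step -/

/-- **The reduction step** `(a, b, θ, θψ) ↦ (|c|, -b, sgn(c)·θψ, θ)`, `c = (Δ - b²)/4a`.
[cite: JacobsonWilliams2008, §5.1 (5.3)–(5.5)] -/
def pstep (Δ : ℕ) (S : St) : St :=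
  ⟨(S.c Δ).natAbs, -S.b, if 0 < S.c Δ then S.r else (-S.r.1, -S.r.2), S.p⟩

/-- The `ρ`-step negates `b`. [folklore] -/
@[simp] theorem pstep_b (S : St) : (Infra.pstep Δ S).b = -S.b := rfl
/-- The `ρ`-step moves `θ` to the second coordinate. [folklore] -/
@[simp] theorem pstep_r (S : St) : (Infra.pstep Δ S).r = S.p := rfl

/-- `c ≠ 0` (as `Δ` is not a square). [folklore] -/
theorem Inv.c_ne_zero (hΔ : IsDisc Δ) (hI : Inv Δ S) : S.c Δ ≠ 0 := by
  intro h0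
  have h := hI.four_a_c
  rw [h0, mul_zero] at h
  have hsq : ((S.b.natAbs ^ 2 : ℕ) : ℤ) = (Δ : ℤ) := by push_cast; rw [sq_abs]; linarith
  have hnat : S.b.natAbs ^ 2 = Δ := by exact_mod_cast hsq
  exact hΔ.nsq ⟨S.b.natAbs, by rw [← hnat, pow_two]⟩

/-- The new norm is `|c|`. [folklore] -/
theorem pstep_a (S : St) : ((Infra.pstep Δ S).a : ℤ) = |S.c Δ| := Int.natCast_natAbs _

/-- `θ' = sgn(c) · θψ` at both embeddings. [cite: JacobsonWilliams2008, §5.1 (5.4)] -/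
theorem Inv.ev_pstep_p_aux (hI : Inv Δ S) {t : ℝ} (ht : t ^ 2 = Δ) :
    ev Δ t (Infra.pstep Δ S).p * (2 * S.a) =
      (if 0 < S.c Δ then (1 : ℝ) else -1) * (ev Δ t S.p * (S.b + t)) := by
  have hold := hI.2.2.1 t ht
  show ev Δ t (if 0 < S.c Δ then S.r else (-S.r.1, -S.r.2)) * (2 * S.a) = _
  split_ifs with h
  · rw [hold]; ring
  · rw [ev_neg]; linear_combination (-1 : ℝ) * hold

/-- **The step preserves the invariant.** [cite: JacobsonWilliams2008, §5.1 (5.3)–(5.5)] -/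
theorem Inv.pstep (hΔ : IsDisc Δ) (hI : Inv Δ S) : Inv Δ (Infra.pstep Δ S) := by
  have hc0 := hI.c_ne_zero hΔ
  have hac := hI.four_a_c
  have hA := pstep_a (Δ := Δ) S
  refine ⟨?_, ?_, ?_, ?_⟩
  · have : (1 : ℤ) ≤ (Infra.pstep Δ S).a := by rw [hA]; exact Int.one_le_abs hc0
    exact_mod_cast this
  · rw [hA, pstep_b]
    have : (Δ : ℤ) - (-S.b) ^ 2 = 4 * S.c Δ * S.a := by linarith
    rw [this]
    exact Dvd.dvd.mul_right (mul_dvd_mul_left (4 : ℤ) (abs_dvd_self (S.c Δ))) _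
  · intro t ht
    have h1 := hI.ev_pstep_p_aux ht
    have hac' : (4 : ℝ) * S.a * S.c Δ = Δ - S.b ^ 2 := by exact_mod_cast hac
    have hA' : (((Infra.pstep Δ S).a : ℕ) : ℝ) = |(S.c Δ : ℝ)| := by
      rw [← Int.cast_abs]; exact_mod_cast hA
    rw [pstep_r, pstep_b, hA']
    have h2a : (2 * (S.a : ℝ)) ≠ 0 := by have := hI.a_pos; positivity
    apply mul_right_cancel₀ h2a
    push_cast
    split_ifs at h1 with h
    · rw [abs_of_pos (by exact_mod_cast h : (0 : ℝ) < S.c Δ)]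
      linear_combination (-(t - S.b)) * h1 + ev Δ t S.p * hac' - ev Δ t S.p * ht
    · push Not at h
      have hneg : S.c Δ < 0 := lt_of_le_of_ne h hc0
      rw [abs_of_neg (by exact_mod_cast hneg : (S.c Δ : ℝ) < 0)]
      linear_combination (-(t - S.b)) * h1 - ev Δ t S.p * hac' + ev Δ t S.p * ht
  · intro q
    obtain ⟨x, y, hq⟩ := hI.2.2.2 q
    show ∃ x' y', q = lin x' y' (if 0 < S.c Δ then S.r else (-S.r.1, -S.r.2)) S.p
    split_ifs
    · exact ⟨y, x, by rw [hq]; unfold lin; ext <;> simp only <;> ring⟩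
    · exact ⟨-y, x, by rw [hq]; unfold lin; ext <;> simp only <;> ring⟩

/-- **`θ' (√Δ - b) = 2|c| θ`**: the new `θ` in product form — so `|θ'| = |θ| · |ψ|` with
`ψ = (b + √Δ)/2a`, and the sign of `θ` flips exactly when `b > √Δ`.
[cite: JacobsonWilliams2008, §5.1 (5.4)–(5.5)] -/
theorem Inv.ev_pstep_p (hΔ : IsDisc Δ) (hI : Inv Δ S) :
    ev Δ (rt Δ) (Infra.pstep Δ S).p * (rt Δ - S.b) = 2 * |(S.c Δ : ℝ)| * ev Δ (rt Δ) S.p := by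
  have h := (hI.pstep hΔ).2.2.1 (rt Δ) (rt_sq Δ)
  have hA' : (((Infra.pstep Δ S).a : ℕ) : ℝ) = |(S.c Δ : ℝ)| := by
    rw [← Int.cast_abs]; exact_mod_cast pstep_a (Δ := Δ) S
  rw [pstep_r, pstep_b, hA'] at h
  push_cast at h
  linear_combination (-1 : ℝ) * h

/-- `ψ (√Δ - b) = 2c` (from `(b + √Δ)(√Δ - b) = Δ - b² = 4ac`). [cite: JacobsonWilliams2008, §5.1 (5.4)] -/
theorem Inv.psi_mul (hI : Inv Δ S) : S.psi (rt Δ) * (rt Δ - S.b) = 2 * S.c Δ := by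
  have hac : (4 : ℝ) * S.a * S.c Δ = Δ - S.b ^ 2 := by exact_mod_cast hI.four_a_c
  have hss := rt_sq Δ
  have ha : (S.a : ℝ) ≠ 0 := ne_of_gt hI.a_pos
  unfold St.psi
  rw [div_mul_eq_mul_div, div_eq_iff (by positivity)]
  linear_combination hss - hac

/-- `|θ'| = |θ| · |ψ|`. [cite: JacobsonWilliams2008, §5.1 (5.9)] -/
theorem Inv.abs_ev_pstep_p (hΔ : IsDisc Δ) (hI : Inv Δ S) :
    |ev Δ (rt Δ) (Infra.pstep Δ S).p| = |ev Δ (rt Δ) S.p| * |S.psi (rt Δ)| := by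
  have h := hI.ev_pstep_p hΔ
  have hsb : rt Δ - S.b ≠ 0 := fun h0 => (irrational_rt hΔ).ne_int S.b (by linarith)
  have hψ : |S.psi (rt Δ)| * |rt Δ - S.b| = 2 * |(S.c Δ : ℝ)| := by
    rw [← abs_mul, hI.psi_mul, abs_mul, abs_of_pos (by norm_num : (0:ℝ) < 2)]
  have habs := congrArg abs h
  rw [abs_mul, abs_mul, abs_mul, abs_of_pos (by norm_num : (0:ℝ) < 2), abs_abs] at habs
  have hpos : 0 < |rt Δ - S.b| := abs_pos.mpr hsb
  have : |ev Δ (rt Δ) (Infra.pstep Δ S).p| * |rt Δ - S.b| =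
      |ev Δ (rt Δ) S.p| * |S.psi (rt Δ)| * |rt Δ - S.b| := by
    rw [habs, mul_assoc (|ev Δ (rt Δ) S.p|), hψ]; ring
  exact mul_right_cancel₀ hpos.ne' this

/-! ### Size control of the step -/

/-- `Δ ≥ 1` (zero is a square). [folklore] -/
theorem IsDisc.one_le (hΔ : IsDisc Δ) : 1 ≤ Δ := by
  by_contra h
  push Not at h
  have : Δ = 0 := by omega
  exact hΔ.nsq ⟨0, by simp [this]⟩

/-- `⌊√Δ⌋² < Δ < (⌊√Δ⌋ + 1)²` for a non-square. [folklore] -/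
theorem nat_sqrt_sq_lt (hΔ : IsDisc Δ) : (Nat.sqrt Δ : ℤ) ^ 2 < Δ ∧ (Δ : ℤ) < (Nat.sqrt Δ + 1) ^ 2 := by
  constructor
  · have h1 : Nat.sqrt Δ ^ 2 ≤ Δ := Nat.sqrt_le' Δ
    rcases h1.lt_or_eq with h | h
    · exact_mod_cast h
    · exact absurd ⟨Nat.sqrt Δ, by rw [← pow_two]; exact h.symm⟩ hΔ.nsq
  · exact_mod_cast Nat.lt_succ_sqrt' Δ

/-- **Phase 1** (`a > √Δ`, `b ∈ (-a, a]`): `|ψ| < 1`, `4|c| ≤ a`, and `|c| < a|ψ|`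
(Jacobson–Williams (5.6): `N(ρ(𝔞)) ≤ (|a| + Δ/|a|)/4`). [cite: JacobsonWilliams2008, §5.1 (5.6)] -/
theorem Norm.phase1 (hΔ : IsDisc Δ) (hI : Inv Δ S) (hN : Norm Δ S) (hbig : (Nat.sqrt Δ : ℤ) < S.a) :
    |S.psi (rt Δ)| < 1 ∧ 4 * |S.c Δ| ≤ S.a ∧ (|S.c Δ| : ℝ) < S.a * |S.psi (rt Δ)| := by
  obtain ⟨hs1, hs2⟩ := nat_sqrt_lt_rt hΔ
  obtain ⟨hb1, hb2⟩ := hN.1 hbig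
  have hsa : rt Δ < S.a := by
    have : (Nat.sqrt Δ : ℝ) + 1 ≤ S.a := by exact_mod_cast hbig
    linarith
  have hb1' : -(S.a : ℝ) < S.b := by exact_mod_cast hb1
  have hb2' : (S.b : ℝ) ≤ S.a := by exact_mod_cast hb2
  have ha := hI.a_pos
  have hs0 := rt_pos hΔ
  have hac : (4 : ℝ) * S.a * S.c Δ = Δ - S.b ^ 2 := by exact_mod_cast hI.four_a_c
  have hss := rt_sq Δ
  -- `|ψ| < 1`
  have hψ : |S.psi (rt Δ)| < 1 := by
    unfold St.psi
    rw [abs_div, abs_of_pos (by positivity : (0:ℝ) < 2 * S.a), div_lt_one (by positivity), abs_lt]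
    constructor <;> linarith
  -- `4a|c| = |Δ - b²| ≤ a²`
  have h4 : (S.a : ℝ) * (4 * |(S.c Δ : ℝ)|) ≤ S.a * S.a := by
    rw [show (S.a : ℝ) * (4 * |(S.c Δ : ℝ)|) = |4 * S.a * (S.c Δ : ℝ)| by
      rw [abs_mul, abs_mul, abs_of_pos (by norm_num : (0:ℝ) < 4), abs_of_pos ha]; ring, hac, abs_le]
    constructor <;> nlinarith
  refine ⟨hψ, ?_, ?_⟩
  · have : (4 : ℝ) * |(S.c Δ : ℝ)| ≤ S.a := le_of_mul_le_mul_left h4 ha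
    rw [← Int.cast_abs] at this
    exact_mod_cast this
  · have hψ2 : |S.psi (rt Δ)| * |rt Δ - S.b| = 2 * |(S.c Δ : ℝ)| := by
      rw [← abs_mul, hI.psi_mul, abs_mul, abs_of_pos (by norm_num : (0:ℝ) < 2)]
    have hsb : |rt Δ - S.b| < 2 * S.a := by rw [abs_lt]; constructor <;> linarith
    have hc0 : (0 : ℝ) < |(S.c Δ : ℝ)| := by
      rw [← Int.cast_abs]; exact_mod_cast Int.one_le_abs (hI.c_ne_zero hΔ)
    have hψ0 : 0 < |S.psi (rt Δ)| := by
      by_contra h0; push Not at h0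
      have : |S.psi (rt Δ)| = 0 := le_antisymm h0 (abs_nonneg _)
      rw [this, zero_mul] at hψ2; linarith
    nlinarith [abs_nonneg (rt Δ - S.b)]

/-- **Phase 2** (`a < √Δ`, `b ∈ (⌊√Δ⌋ - 2a, ⌊√Δ⌋]`, not reduced): `0 < ψ < 1`, `2Δψ > 1`, and the next
norm `c` satisfies `0 < c`, `2c ≤ ⌊√Δ⌋` (Jacobson–Williams Thm. 5.9: then the next ideal is reduced).
[cite: JacobsonWilliams2008, §5.1 Thm. 5.9, (5.6)] -/
theorem Norm.phase2 (hΔ : IsDisc Δ) (hI : Inv Δ S) (hN : Norm Δ S) (hsmall : (S.a : ℤ) ≤ Nat.sqrt Δ)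
    (hnr : ¬ Red Δ S) :
    0 < S.psi (rt Δ) ∧ S.psi (rt Δ) < 1 ∧ 1 < 2 * Δ * S.psi (rt Δ) ∧ 0 < S.c Δ ∧
      2 * S.c Δ ≤ Nat.sqrt Δ := by
  obtain ⟨hs1, hs2⟩ := nat_sqrt_lt_rt hΔ
  obtain ⟨hN2, hNΔ⟩ := nat_sqrt_sq_lt hΔ
  obtain ⟨hb1, hb2⟩ := hN.2 hsmall
  have ha1 : (1 : ℤ) ≤ S.a := by exact_mod_cast hI.1
  rw [← redTest_iff hΔ] at hnr
  unfold RedTest at hnr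
  have h3 : (Nat.sqrt Δ : ℤ) + 1 ≤ 2 * S.a - S.b := by omega
  have ha := hI.a_pos
  have hs0 := rt_pos hΔ
  have hss := rt_sq Δ
  have hac := hI.four_a_c
  have hb1' : (Nat.sqrt Δ : ℝ) - 2 * S.a + 1 ≤ S.b := by
    exact_mod_cast (show (Nat.sqrt Δ : ℤ) - 2 * S.a + 1 ≤ S.b by omega)
  have h3' : (Nat.sqrt Δ : ℝ) + 1 ≤ 2 * S.a - S.b := by exact_mod_cast h3
  have hsa' : (S.a : ℝ) ≤ Nat.sqrt Δ := by exact_mod_cast hsmall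
  have h2a : (0 : ℝ) < 2 * S.a := by positivity
  -- `c > 0` and `2c ≤ ⌊√Δ⌋`
  have hbN : -(Nat.sqrt Δ : ℤ) < S.b := by omega
  have hbsq : S.b ^ 2 < (Δ : ℤ) := by nlinarith
  have hc : 0 < S.c Δ := by nlinarith
  have hc2 : 2 * S.c Δ ≤ Nat.sqrt Δ := by
    by_contra hcon
    push Not at hcon
    have h4a : 2 * (Nat.sqrt Δ : ℤ) + 2 ≤ 4 * S.a := by omega
    nlinarith
  refine ⟨?_, ?_, ?_, hc, hc2⟩
  · unfold St.psi; apply div_pos _ h2a; linarith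
  · unfold St.psi; rw [div_lt_one h2a]; linarith
  · have hgap : (1 : ℝ) ≤ (rt Δ - S.a) * (rt Δ + S.a) := by
      have h' : (S.a : ℤ) ^ 2 + 1 ≤ Δ := by nlinarith
      have : (S.a : ℝ) ^ 2 + 1 ≤ Δ := by exact_mod_cast h'
      nlinarith
    have hsa : (S.a : ℝ) < rt Δ := by linarith
    have h1 : 1 < 2 * rt Δ * (rt Δ - S.a) := by nlinarith
    have h2 : (S.a : ℝ) < 2 * Δ * (rt Δ - S.a) := by rw [← hss]; nlinarith
    have h3 : 2 * (rt Δ - S.a) < S.b + rt Δ := by linarith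
    have hΔ0 : (0 : ℝ) < Δ := by rw [← hss]; positivity
    have ha' : (S.a : ℝ) ≠ 0 := ne_of_gt ha
    unfold St.psi
    rw [show (2 : ℝ) * Δ * ((S.b + rt Δ) / (2 * S.a)) = Δ * (S.b + rt Δ) / S.a by field_simp,
      lt_div_iff₀ ha]
    nlinarith [mul_lt_mul_of_pos_left h3 hΔ0]

/-! ### The loop -/

/-- One round: stop if reduced, else step and normalise. [cite: JacobsonWilliams2008, §5.2 (reduction algorithm)] -/
def rloop (Δ : ℕ) (S : St) : St := if RedTest Δ S then S else Infra.normalize Δ (Infra.pstep Δ S)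

/-- `reduce S n`: normalise, then `n` rounds. [cite: JacobsonWilliams2008, §5.2 (reduction algorithm)] -/
def reduce (Δ : ℕ) (S : St) (n : ℕ) : St := (rloop Δ)^[n] (Infra.normalize Δ S)

/-- A reduced frame is fixed by the loop. [folklore] -/
theorem rloop_of_red (hΔ : IsDisc Δ) (hR : Red Δ S) : rloop Δ S = S :=
  if_pos ((redTest_iff hΔ S).mpr hR)

/-- A non-reduced frame is stepped and normalised. [folklore] -/
theorem rloop_of_not_red (hΔ : IsDisc Δ) (hR : ¬ Red Δ S) : rloop Δ S = Infra.normalize Δ (Infra.pstep Δ S) :=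
  if_neg (fun h => hR ((redTest_iff hΔ S).mp h))

/-- `reduce S 0 = normalize S`. [folklore] -/
@[simp] theorem reduce_zero (S : St) : reduce Δ S 0 = Infra.normalize Δ S := rfl

/-- `reduce S (n+1) = rloop (reduce S n)`. [folklore] -/
theorem reduce_succ (S : St) (n : ℕ) : reduce Δ S (n + 1) = rloop Δ (reduce Δ S n) := by
  unfold reduce; rw [Function.iterate_succ_apply']

/-- Once reduced, the loop stays put. [folklore] -/
theorem reduce_eq_of_red (hΔ : IsDisc Δ) {k : ℕ} (hR : Red Δ (reduce Δ S k)) :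
    ∀ m, k ≤ m → reduce Δ S m = reduce Δ S k := by
  intro m hm
  induction m, hm using Nat.le_induction with
  | base => rfl
  | succ m _ ih => rw [reduce_succ, ih, rloop_of_red hΔ hR]

/-- **A small non-reduced normalised frame becomes reduced in one round** (Jacobson–Williams
Thm. 5.9). [cite: JacobsonWilliams2008, §5.1 Thm. 5.9] -/
theorem Norm.red_rloop (hΔ : IsDisc Δ) (hI : Inv Δ S) (hN : Norm Δ S) (hsmall : (S.a : ℤ) ≤ Nat.sqrt Δ)
    (hnr : ¬ Red Δ S) : Red Δ (rloop Δ S) := by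
  obtain ⟨_, _, _, hc, hc2⟩ := hN.phase2 hΔ hI hsmall hnr
  rw [rloop_of_not_red hΔ hnr]
  have hI' := (hI.pstep hΔ).normalize
  have hA : ((Infra.pstep Δ S).a : ℤ) = S.c Δ := by rw [pstep_a, abs_of_pos hc]
  apply (norm_normalize (Δ := Δ) (hI.pstep hΔ).1).red_of_small hΔ _ hI'.1
  rw [normalize_a, hA]
  omega

/-- The bookkeeping invariant of the reduction loop after `n` rounds, relative to the initial
frame `S₀` (with `θ₀ = |θ(S₀)|`, `a₀ = a(S₀)`). [cite: JacobsonWilliams2008, §5.1 (5.12)] -/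
structure RedInv (Δ : ℕ) (S₀ T : St) (n : ℕ) : Prop where
  /-- the frame invariant -/
  inv : Inv Δ T
  /-- `b` is normalised -/
  norm : Norm Δ T
  /-- the distance has not grown -/
  le : |ev Δ (rt Δ) T.p| ≤ |ev Δ (rt Δ) S₀.p|
  /-- phase 1: `|θ| ≥ (a/a₀)|θ₀|` and `a ≤ a₀/4ⁿ` -/
  big : (Nat.sqrt Δ : ℤ) < T.a →
    (T.a : ℝ) * |ev Δ (rt Δ) S₀.p| ≤ S₀.a * |ev Δ (rt Δ) T.p| ∧ T.a * 4 ^ n ≤ S₀.a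
  /-- between the phases: `|θ| ≥ |θ₀|/a₀` -/
  mid : (T.a : ℤ) ≤ Nat.sqrt Δ → ¬ Red Δ T → |ev Δ (rt Δ) S₀.p| ≤ S₀.a * |ev Δ (rt Δ) T.p|
  /-- at the end: `|θ| ≥ |θ₀|/(2Δa₀)` -/
  fin : Red Δ T → |ev Δ (rt Δ) S₀.p| ≤ 2 * Δ * S₀.a * |ev Δ (rt Δ) T.p|

/-- The invariant holds initially. [folklore] -/
theorem Inv.redInv_zero (hΔ : IsDisc Δ) (hI : Inv Δ S) : RedInv Δ S (Infra.normalize Δ S) 0 := by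
  have ha1 : (1 : ℝ) ≤ S.a := by exact_mod_cast hI.1
  have hΔ1 : (1 : ℝ) ≤ Δ := by exact_mod_cast hΔ.one_le
  have hθ := abs_nonneg (ev Δ (rt Δ) S.p)
  have h2 : (1 : ℝ) ≤ 2 * Δ * S.a := by nlinarith
  refine ⟨hI.normalize, norm_normalize hI.1, by simp, fun _ => ⟨by simp, by simp⟩, fun _ _ => ?_, fun _ => ?_⟩
  · simp only [normalize_p]; nlinarith
  · simp only [normalize_p]; nlinarith

/-- **One round preserves the invariant** (the case analysis of Jacobson–Williams §5.1–5.2).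
[cite: JacobsonWilliams2008, §5.1 (5.6), Thm. 5.9, (5.12)] -/
theorem RedInv.succ (hΔ : IsDisc Δ) {S₀ T : St} {n : ℕ} (h : RedInv Δ S₀ T n) :
    RedInv Δ S₀ (rloop Δ T) (n + 1) := by
  have hI := h.inv
  have hθ0 := abs_nonneg (ev Δ (rt Δ) S₀.p)
  have hΔ1 : (1 : ℝ) ≤ Δ := by exact_mod_cast hΔ.one_le
  by_cases hR : Red Δ T
  · rw [rloop_of_red hΔ hR]
    have hsmall := hR.a_le_sqrt hΔ
    exact ⟨hI, h.norm, h.le, fun hbig => absurd hbig (not_lt.mpr hsmall), fun _ hnr => absurd hR hnr, h.fin⟩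
  · rw [rloop_of_not_red hΔ hR]
    have hI' : Inv Δ (Infra.normalize Δ (Infra.pstep Δ T)) := (hI.pstep hΔ).normalize
    have hN' : Norm Δ (Infra.normalize Δ (Infra.pstep Δ T)) := norm_normalize (hI.pstep hΔ).1
    have hθ' : |ev Δ (rt Δ) (Infra.normalize Δ (Infra.pstep Δ T)).p| = |ev Δ (rt Δ) T.p| * |T.psi (rt Δ)| := by
      rw [normalize_p]; exact hI.abs_ev_pstep_p hΔ
    have hA : ((Infra.normalize Δ (Infra.pstep Δ T)).a : ℤ) = |T.c Δ| := by rw [normalize_a]; exact pstep_a T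
    have hA' : (((Infra.normalize Δ (Infra.pstep Δ T)).a : ℕ) : ℝ) = |(T.c Δ : ℝ)| := by
      rw [← Int.cast_abs]; exact_mod_cast hA
    have hθT := abs_nonneg (ev Δ (rt Δ) T.p)
    have hψT := abs_nonneg (T.psi (rt Δ))
    by_cases hbig : (Nat.sqrt Δ : ℤ) < T.a
    · -- phase 1
      obtain ⟨hψ1, h4c, hca⟩ := h.norm.phase1 hΔ hI hbig
      obtain ⟨hbd, hpow⟩ := h.big hbig
      have hle' : |ev Δ (rt Δ) T.p| * |T.psi (rt Δ)| ≤ |ev Δ (rt Δ) T.p| :=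
        mul_le_of_le_one_right hθT hψ1.le
      have hkey : |(T.c Δ : ℝ)| * |ev Δ (rt Δ) S₀.p| ≤ S₀.a * (|ev Δ (rt Δ) T.p| * |T.psi (rt Δ)|) := by
        have h1 : |(T.c Δ : ℝ)| * |ev Δ (rt Δ) S₀.p| ≤ T.a * |T.psi (rt Δ)| * |ev Δ (rt Δ) S₀.p| :=
          mul_le_mul_of_nonneg_right hca.le hθ0
        have h2 : (T.a : ℝ) * |ev Δ (rt Δ) S₀.p| * |T.psi (rt Δ)| ≤ S₀.a * |ev Δ (rt Δ) T.p| * |T.psi (rt Δ)| :=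
          mul_le_mul_of_nonneg_right hbd hψT
        nlinarith
      have hc1 : (1 : ℝ) ≤ |(T.c Δ : ℝ)| := by
        rw [← Int.cast_abs]; exact_mod_cast Int.one_le_abs (hI.c_ne_zero hΔ)
      refine ⟨hI', hN', ?_, fun _ => ⟨?_, ?_⟩, fun _ _ => ?_, fun _ => ?_⟩
      · rw [hθ']; exact hle'.trans h.le
      · rw [hA', hθ']; exact hkey
      · have h1 : ((Infra.normalize Δ (Infra.pstep Δ T)).a : ℤ) * 4 ^ (n + 1) ≤ S₀.a := by
          rw [hA, pow_succ]
          have : (T.a : ℤ) * 4 ^ n ≤ S₀.a := by exact_mod_cast hpow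
          have h4 : (0 : ℤ) ≤ 4 ^ n := by positivity
          nlinarith
        exact_mod_cast h1
      · rw [hθ']; nlinarith
      · rw [hθ']
        have : (0 : ℝ) ≤ S₀.a * (|ev Δ (rt Δ) T.p| * |T.psi (rt Δ)|) := by positivity
        nlinarith
    · -- phase 2
      push Not at hbig
      obtain ⟨hψ0, hψ1, h2Δ, hc, hc2⟩ := h.norm.phase2 hΔ hI hbig hR
      have hmid := h.mid hbig hR
      have hRed' : Red Δ (Infra.normalize Δ (Infra.pstep Δ T)) := by
        rw [← rloop_of_not_red hΔ hR]; exact h.norm.red_rloop hΔ hI hbig hR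
      have habsψ : |T.psi (rt Δ)| = T.psi (rt Δ) := abs_of_pos hψ0
      refine ⟨hI', hN', ?_, fun hbig' => ?_, fun _ hnr => absurd hRed' hnr, fun _ => ?_⟩
      · rw [hθ', habsψ]
        exact (mul_le_of_le_one_right hθT hψ1.le).trans h.le
      · exfalso
        rw [hA, abs_of_pos hc] at hbig'
        omega
      · rw [hθ', habsψ]
        have ha0 : (0 : ℝ) ≤ S₀.a * |ev Δ (rt Δ) T.p| := by positivity
        nlinarith

/-- **Termination and distance correction of the reduction**: after `n ≥ L + 1` rounds with
`4ᴸ > a`, the frame is reduced, satisfies the invariant, and `|θ|/(2Δa) ≤ |θ_n| ≤ |θ|`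
(Jacobson–Williams (5.12), `r/Q₀ < |θ_m| < 2`, in a form sufficient for polynomial time).
[cite: JacobsonWilliams2008, §5.1 (5.12), §5.2] -/
theorem Inv.reduce_spec (hΔ : IsDisc Δ) (hI : Inv Δ S) {L n : ℕ} (hL : S.a < 4 ^ L) (hn : L + 1 ≤ n) :
    Inv Δ (reduce Δ S n) ∧ Red Δ (reduce Δ S n) ∧
      |ev Δ (rt Δ) (reduce Δ S n).p| ≤ |ev Δ (rt Δ) S.p| ∧
      |ev Δ (rt Δ) S.p| ≤ 2 * Δ * S.a * |ev Δ (rt Δ) (reduce Δ S n).p| := by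
  have J : ∀ k, RedInv Δ S (reduce Δ S k) k := by
    intro k
    induction k with
    | zero => exact hI.redInv_zero hΔ
    | succ k ih => rw [reduce_succ]; exact ih.succ hΔ
  have hJL := J L
  have hsmall : ((reduce Δ S L).a : ℤ) ≤ Nat.sqrt Δ := by
    by_contra hb
    push Not at hb
    obtain ⟨_, hpow⟩ := hJL.big hb
    have h1 : 1 ≤ (reduce Δ S L).a := hJL.inv.1
    have : 1 * 4 ^ L ≤ (reduce Δ S L).a * 4 ^ L := Nat.mul_le_mul_right _ h1
    omega
  by_cases hR : Red Δ (reduce Δ S L)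
  · rw [reduce_eq_of_red hΔ hR n (by omega)]
    exact ⟨hJL.inv, hR, hJL.le, hJL.fin hR⟩
  · have hR1 : Red Δ (reduce Δ S (L + 1)) := by
      rw [reduce_succ]; exact hJL.norm.red_rloop hΔ hJL.inv hsmall hR
    have hJ1 := J (L + 1)
    rw [reduce_eq_of_red hΔ hR1 n hn]
    exact ⟨hJ1.inv, hR1, hJ1.le, hJ1.fin hR1⟩

end Literature.NumberTheory.QuadraticFields.Infra

end
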